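import Summits.Ventures.CertifiedQuantumChemistry.Rows.StrongCouplingBudgetBounds
import Summits.Ventures.CertifiedQuantumChemistry.Rows.StrongCouplingDegreeBound
import HarnessLib

/-!
# Ventures/CertifiedQuantumChemistry — Rows/HubbardRingTVEntryBoundsLinear.lean: CLAIM N step (1) on
# the TV-H files WITH THE EXTENSIVE CONSTANT — every entry class of an optimal pair is controlled by
# `C = 8|t|√L/U` (budget `C² = 64t²L/U²`), unconditionally at half filling

HONEST FRAMING (verbatim): certified bounds for a stated model Hamiltonian in a stated basis; not a
claim about the real molecule beyond that model. Nothing here is a state, a row, a claim node or a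
value of record; the statement is about an (arbitrary) OPTIMAL feasible pair of the abstract
`D, Q, G` sector programme of the cell's test-vector tables `hubbardRingTV L t U`.

Seat rdm-B (gen 36), zero compute; one theorem (no `def`). The join of two files of the same gen:
`Rows/StrongCouplingBudgetBounds.lean` (§4: ANY doublon budget `Σ_p Re d_p ≤ S` bounds every entry class
the words of CLAIM N step (1) name; §5 instantiated it with the crude all-pairs budget
`S = 16t²L³/U²`) and `Rows/StrongCouplingDegreeBound.lean` (the EXTENSIVE budget from the row sums of
`‖h‖`: `S = 64t²L/U²` on the ring, `StrongCouplingGap.hubbardRingTV_optimal_sum_doublon_le_linear`).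
**`hubbardRingTV_optimal_entry_bounds_linear`**: for `L ≥ 2`, `U > 0`, `a + b = L`, an optimal pair
of the sector programme of `hubbardRingTV L t U` exists and, with `C := 8|t|√L/U`, has every doublon
and holon weight `≤ C²`, every site within `(Re n_p − 1)² ≤ 2C²` of single occupancy, every hop
`‖γ_{pσ,qσ}‖ ≤ 2C` (`p ≠ q`), every `D`- / `Q`-entry against a doubly occupied pair index `≤ C` (all
pair indices `r`, adjacent or not), every doublon–doublon / holon–holon entry `≤ C²` and every
connected density–density moment `‖w_p†Ĝw_q‖ ≤ 2C²` — the same list as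
`StrongCouplingEntry.hubbardRingTV_optimal_entry_bounds` with `L³` replaced by `L`.

Everything is PROVED (0 sorry), standard axioms; no definitions, no named facts; no claim node, hint,
row or CERTIFIED cell depends on it. References (docstring-only): as in the two joined files.
-/

noncomputable section

namespace Summit.Ventures.CertifiedQuantumChemistry

open Matrix Finset
open Literature.MathematicalPhysics.QuantumLattice Literature.MathematicalPhysics.QuantumChemistry
open Summit.Ventures.CertifiedQuantumChemistry.Hamiltonians
open scoped ComplexOrder

namespace StrongCouplingEntry

/-- **CLAIM N STEP (1), THE WHOLE LIST WITH THE EXTENSIVE CONSTANT, AT THE TV-H OPTIMUM.** For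
`hubbardRingTV L t U` at half filling `a + b = L ≥ 2`, `U > 0`, an OPTIMAL feasible pair of the
`D, Q, G` sector programme exists and, with `C := 8|t|√L/U` (`C² = 64t²L/U²`, the row-sum budget of
`Rows/StrongCouplingDegreeBound.lean`), obeys: doublon and holon weights `≤ C²`,
`(Re n_p − 1)² ≤ 2C²`; hops `‖γ_{pσ,qσ}‖ ≤ 2C` (`p ≠ q`); `‖Γ_{r,(p↑,p↓)}‖, ‖²Q_{r,(p↑,p↓)}‖ ≤ C` for
every pair index `r`; `‖Γ_{(p↑,p↓),(q↑,q↓)}‖, ‖²Q_{(p↑,p↓),(q↑,q↓)}‖ ≤ C²`; `‖w_p†Ĝw_q‖ ≤ 2C²`.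
[folklore] -/
theorem hubbardRingTV_optimal_entry_bounds_linear {L : ℕ} (hL : 2 ≤ L) (t : ℚ) {U : ℚ}
    (hU : 0 < U) {a b : ℕ} (hN : a + b = L) :
    ∃ (γ : Matrix (Orb (Fin L)) (Orb (Fin L)) ℂ)
      (Γ : Matrix (Orb (Fin L) × Orb (Fin L)) (Orb (Fin L) × Orb (Fin L)) ℂ),
      IsDQGFeasibleSector a b γ Γ ∧
      (rdmEnergy (fun p q => ((hubbardRingTV L t U).h p q : ℂ))
          (fun p q r s => ((hubbardRingTV L t U).eri p q r s : ℂ))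
          ((hubbardRingTV L t U).ecore : ℂ) γ Γ).re
        = pqgSectorEnergy (fun p q => ((hubbardRingTV L t U).h p q : ℂ))
          (fun p q r s => ((hubbardRingTV L t U).eri p q r s : ℂ))
          ((hubbardRingTV L t U).ecore : ℂ) a b ∧
      (∀ p : Fin L,
        (Γ (orb p 0, orb p 1) (orb p 0, orb p 1)).re ≤ (8 * |(t : ℝ)| * Real.sqrt L / U) ^ 2 ∧
        (qMap γ Γ (orb p 0, orb p 1) (orb p 0, orb p 1)).re ≤ (8 * |(t : ℝ)| * Real.sqrt L / U) ^ 2 ∧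
        ((γ (orb p 0) (orb p 0)).re + (γ (orb p 1) (orb p 1)).re - 1) ^ 2
          ≤ 2 * (8 * |(t : ℝ)| * Real.sqrt L / U) ^ 2) ∧
      (∀ p q : Fin L, p ≠ q → ∀ σ : Fin 2,
        ‖γ (orb p σ) (orb q σ)‖ ≤ 2 * (8 * |(t : ℝ)| * Real.sqrt L / U)) ∧
      (∀ (r : Orb (Fin L) × Orb (Fin L)) (p : Fin L),
        ‖Γ r (orb p 0, orb p 1)‖ ≤ 8 * |(t : ℝ)| * Real.sqrt L / U ∧
        ‖qMap γ Γ r (orb p 0, orb p 1)‖ ≤ 8 * |(t : ℝ)| * Real.sqrt L / U) ∧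
      (∀ p q : Fin L,
        ‖Γ (orb p 0, orb p 1) (orb q 0, orb q 1)‖ ≤ (8 * |(t : ℝ)| * Real.sqrt L / U) ^ 2 ∧
        ‖qMap γ Γ (orb p 0, orb p 1) (orb q 0, orb q 1)‖ ≤ (8 * |(t : ℝ)| * Real.sqrt L / U) ^ 2 ∧
        ‖star (Pi.single (orb p 0, orb p 0) (1 : ℂ) + Pi.single (orb p 1, orb p 1) 1) ⬝ᵥ
            (gMap γ Γ - vecMulVec (fun r : Orb (Fin L) × Orb (Fin L) => γ r.1 r.2)
              (star fun r : Orb (Fin L) × Orb (Fin L) => γ r.1 r.2)) *ᵥ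
            (Pi.single (orb q 0, orb q 0) (1 : ℂ) + Pi.single (orb q 1, orb q 1) 1)‖
          ≤ 2 * (8 * |(t : ℝ)| * Real.sqrt L / U) ^ 2) := by
  obtain ⟨γ, Γ, hf, hE, hs⟩ :=
    StrongCouplingGap.hubbardRingTV_optimal_sum_doublon_le_linear hL t hU hN
  have hcard : a + b = Fintype.card (Fin L) := by rw [Fintype.card_fin]; exact hN
  have hΛ : 2 ≤ Fintype.card (Fin L) := by rw [Fintype.card_fin]; exact hL
  have hU' : (0 : ℝ) < (U : ℝ) := by exact_mod_cast hU
  have hC : 0 ≤ 8 * |(t : ℝ)| * Real.sqrt L / U := by positivity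
  have hsq : Real.sqrt ((8 * |(t : ℝ)| * Real.sqrt L / U) ^ 2)
      = 8 * |(t : ℝ)| * Real.sqrt L / U := Real.sqrt_sq hC
  refine ⟨γ, Γ, hf, hE, fun p => ⟨doublon_re_le hf.dqg hs p, holon_re_le hf hcard hs p,
    sq_occupation_sub_one_le_two_mul hf hcard hs p⟩, fun p q hpq σ => ?_, fun r p => ⟨?_, ?_⟩,
    fun p q => ⟨norm_two_apply_doublon_doublon_le hf.dqg hs p q,
      norm_qMap_apply_holon_holon_le hf hcard hs p q,
      norm_chargeForm_gHat_le_two_mul hf hcard hs p q⟩⟩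
  · have h := norm_hop_le hf hcard hΛ hs hpq σ
    rwa [hsq] at h
  · have h := norm_two_apply_doublon_le hf.dqg hs r p
    rwa [hsq] at h
  · have h := norm_qMap_apply_holon_le hf hcard hs r p
    rwa [hsq] at h

end StrongCouplingEntry

end Summit.Ventures.CertifiedQuantumChemistry
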